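import Literature.MathematicalPhysics.QuantumFieldTheory.Balaban1983to89.B16Ineq131Assembly
import Literature.MathematicalPhysics.QuantumFieldTheory.Balaban1983to89.B16Sect1Statements

/-!
# `Balaban1983to89.B16Sect1BoxCounts` — T. Bałaban, *Large field renormalization. II. Localization, exponentiation, and
bounds for the 𝐑 operation*, Commun. Math. Phys. **122** (1989) 355–392 [Balaban1989LargeFieldII], Sect. 1: the
LATTICE-POINT COUNTS behind (1.6)/(1.11)/p. 358 (`|Λ| ≦ (100M)⁴`), (1.31) (the number of plaquettes in `supp ζ₁ ⊂
Z″_{h+1}`) and (1.47) (`|Γ″_h ∩ Ω″^{~2}_{h+1}|`), DERIVED on the shared torus carrier of `…Balaban1983to89.Setup` from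
BOX CONTAINMENT — the conditions (i)/(ii) of [Balaban1989LargeFieldI] p. 177 and the parallelepiped structure (1.10)–(1.12)
p. 179 / p. 195 there — instead of being taken as raw numerical hypotheses (SKELETON rows B16.Eq1.31, B16.Eq1.47, B16.Eq1.6,
B16.Eq1.11, B16.Lem@358)

statement-level skeleton of published theorems with citation tags; proofs where landed; nothing here is a claim about
the Yang–Mills mass gap

PDF held: `paper:balaban1989-cmp122-large-field-ii` (journal page = PDF page + 354); [IV] = [Balaban1989LargeFieldI]
(held `paper:balaban1989-cmp122-large-field-i`, journal page = PDF page + 174).  The quotations below were READ AS IMAGES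
by this seat on the x2 renders `run/shared/lean/pub/pub-balaban/b2b-balaban-ref1/pages/1989-cmp122-large-field-II/…-p003,
p010-x2.png` (pp. 357, 364) and `…/1989-cmp122-large-field-I/…-p005, p021-x2.png` (pp. 179, 195); [IV] p. 177 from the
OCR text layer (`lit read`), cross-checked against the verbatim quotation in `…B16Stage3Regions`.

CITATION HEADER / WHAT IS REPRODUCED (mega-formalization `lit-balaban`, reader/typer r13 gen 10; HOME
`run/shared/lean/pub/lit-balaban/`, rows `lit-balaban-r13/ROWS-B16.md` v2.31): the COUNTING inputs of rows
**B16.Eq1.31** (hypothesis `hS` of `…B16Ineq131Assembly.ineq131_of_inputs`, r13 gen 7 p252456), **B16.Eq1.47**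
(hypothesis `hΓ` of `…B16Sect1Statements.ineq147_lastStep`, r13 gen 2 p240851) and **B16.Eq1.6 / B16.Eq1.11 /
B16.Lem@358** (hypothesis `volΛ ≤ (100M)⁴` of `…B16Sect1Wilson.ineq16_arith`, `…ineq111_arith`,
`…B16Sect1Statements.denomLower358_M4`).

WHAT IS PRINTED (verbatim).
* B16 p. 364 [PDF 10]: *"The second term on the right-hand side can be estimated as follows: 0 ≦ A(ζ₁, U₀) <
  g_k²L^{−4N}N^{4β₀}O(1)A₀²B₃²B₅²M^{14}R_k⁴p₀²(g_k). (1.31)"* — no derivation printed; p. 360 [PDF 6]: *"We take a function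
  ζ₁ ∈ C₀^∞(Z″_{h+1}), which changes from 0 to 1 on a neighborhood of the boundary ∂Z″_{h+1}"*.
* B16 p. 357 [PDF 3], after (1.6): *"where we have used the fact that Λ is contained in a cube of the size 100M."*;
  p. 358 [PDF 4]: *"|I(U₀)| < O(1) log M|Λ| < O(1)M⁵. (1.11)"*.
* B16 p. 368 [PDF 14], (1.47), last two lines: *"≦ O(1)A₀C₁B₃³B₅M⁶p₀(g_k)q₁(g_k)R_k²L^{−N}|Γ″_h ∩ Ω″^{~2}_{h+1}| ≦
  O(1)A₀C₁B₃³B₅M^{10}p₀(g_k)q₁(g_k)R_k⁷L^{−N}."*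
* [IV] p. 177 [PDF 3]: *"we consider the class of components such that each satisfies the following two properties: (i)
  it is contained in a cube of the size 100 MR_k, (ii) in the preceding N renormalization steps no new large field regions
  were created inside this component, and the previous regions contained in it satisfy the condition (i) on the
  corresponding scales. According to our rule of construction of the large field regions, for such a component all the
  regions connected with the last N steps are rectangular parallelepipeds."*; p. 178: *"h = k − N"*.
* [IV] p. 179 [PDF 5]: *"Let us recall that the domains Ω_j^{~n} are unions of L^{−(k−j)}MR_j-cubes of the lattice T_η."*,
  (1.11) *"Z″_j = (Ω_j^{~5})ᶜ ∩ Z for j = k − N₀, k − N₀ − 1, …, k − N + 1 = h + 1"*, (1.12)–(1.13) *"Ω″_j = (Z″ᶜ_j ∩ Z) ∪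
  (Ω_j ∩ Zᶜ) for j = k, k − 1, …, h + 1, … Γ″_j = (Ω″_j∖Ω″_{j+1})^{(j)}, j = k − 1, …, 1"*, and *"By the definition all
  components of the domains Z″_j are also rectangular parallelepipeds for j = h, h + 1, …, k."*
* [IV] p. 195 [PDF 21]: *"At this point we make an essential use of the fact that the domains Λ ⊃ Z″_k ⊃ ⋯ ⊃ Z″_{h+1} ⊃
  (Ω″^{~2}_{h+1})ᶜ are rectangular parallelepipeds."*; p. 192 [PDF 18]: *"Λ … by the condition (i) it is a rectangular
  parallelepiped contained in a cube of the size 100M."*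

READING (declared; the cell transcript's reconstruction `[CERT arithmetic]` at (1.31), and the HANDOFF note of r13 gen 9
«the (1.31) support count needs [IV] (ii) per-scale geometry»).  Lengths: the unit is the scale-`k` lattice; the fine
lattice `T_η` has spacing `η = L^{−k}`; the scale-`j` lattice has spacing `L^{−(k−j)}` ([IV] p. 179), so with `h = k − N`
the scale-`(h+1)` lattice has spacing `L^{−(N−1)} = L·L^{−N}` and the scale-`h` lattice `L^{−N}`.  By (ii) + (i) on
scale `h + 1` and (1.11), the region `Z″_{h+1}` (inside the component under treatment) is ONE rectangular parallelepiped
([IV] p. 195) inside a cube of `C₀·MR_{h+1}` scale-`(h+1)` units, `C₀ = 100` as printed (kept a parameter: the printed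
"100" refers to the large field region `Z_{h+1} ⊃ Z″_{h+1}` of that scale); hence (a) `supp ζ₁ ⊂ Z″_{h+1}` lies in a box
of `n ≦ C₀MR_{h+1}·L·L^{−N}·η⁻¹` sites of the fine lattice per direction — hypothesis `hn` of §2; (b) `Γ″_h ∩ Ω″^{~2}_{h+1}`,
a set of scale-`h` lattice points inside `Z″_{h+1}` (the two added layers of `Ω″^{~2}_{h+1}` lie in `Z″_{h+1} = Z∖Ω″_{h+1}`,
(1.12)), lies in a box of `n ≦ C₀·L·MR_{h+1}` scale-`h` sites per direction — hypothesis `hn` of §3; (c) `Λ` lies in a box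
of `n ≦ 100M` unit-lattice sites per direction (B16 p. 357, [IV] p. 192) — §4.  Boxes are taken on the torus `T^{(j)}`
of `…Setup` as translates `a + [0, n)^d` (`boxSites`); only UPPER BOUNDS on cardinalities are used, so wrap-around is
immaterial.

WHAT IS HERE (every `theorem` PROVED; no `sorry`, no axiom, no new `Prop` fact).
* §1 `boxSites`, `boxPlaqs` and `card_boxSites_le` (`≦ n^d`), `card_boxPlaqs_le` (`≦ d²·n^d`: a plaquette is its base
  point and an ordered pair of directions), `card_le_of_subset_boxSites(_real)`, `card_boxPlaqs_le_real`.
* §2 (1.31): `suppCount131_of_box` — at `d = 4`, `#(boxPlaqs a n) ≦ (16C₀⁴L⁴)·M⁴R_{h+1}⁴(L⁻¹)^{4N}(η⁴)⁻¹` from `hn`, i.e.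
  the hypothesis `hS` of `B16Ineq131Assembly.ineq131_of_inputs` with `C₁ = 16C₀⁴L⁴`; **`ineq131_of_box`** — the row
  B16.Eq1.31 AS TYPED (`B16Sect1Wilson.Ineq131`) for a weight `0 ≦ ζ₁ ≦ 1` supported in the box, with the `O(1)` explicit
  as `16C₀⁴L⁴C₂²C₃⁴ + 1` (the other inputs — (1.80) [IV]-shape deviation, trace inequality, `ε_k = g_kA₀p₀(g_k)`,
  `R_{h+1} ≦ C₃N^{β₀}R_k` — exactly as in the gen-7 assembly).  NOTE (print level, immaterial): the count carries `L⁴`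
  (the scale-`(h+1)` spacing is `L·L^{−N}`, [IV] p. 179 with `h = k − N`), absorbed here into the printed `O(1)`.
* §3 (1.47): `cardΓ147_of_box` — `|Γ| ≦ (C₀LC₃)⁴M⁴R_k⁵` for a set `Γ` of scale-`h` sites in a box of side
  `n ≦ C₀LMR_{h+1}`, using `R_{h+1} ≦ C₃N^{β₀}R_k`, `4β₀ ≦ 1`, `1 ≦ N ≦ R_k` (`N^{4β₀} ≦ N ≦ R_k` supplies the fifth power of
  `R_k`); `ineq147_lastStep_of_box` — the last step of (1.47) with its count input discharged (`O(1) = C·(C₀LC₃)⁴`).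
* §4 p. 357/358: `volΛ_le_of_box` — `|Λ| ≦ (100M)⁴` for `Λ` in a box of side `n ≦ 100M` (`d = 4`); knitted into
  `ineq16_mid_le_of_box` ((1.6) middle expression ≦ final), `ineq111_arith_of_box` ((1.11) second inequality) and
  `denomLower358_of_box` (p. 358 `exp(−O(1)|Λ|) = exp(−O(M⁴))`).
NOT HERE: the bound (1.80) [IV] itself, the construction of `Z″_{h+1}`, `Γ″_h`, `Λ` from the large field regions (they enter
as the box hypotheses above), the count `|𝔹₀| ≦ (100MR_k)^dN²` of p. 361 (its multi-scale geometry is not reconstructed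
here), the N-window.  Nothing printed is asserted as a fact.
-/

namespace Literature.MathematicalPhysics.QuantumFieldTheory.Balaban1983to89.B16Sect1BoxCounts

open B16Sect1Wilson GaugeField Finset

/-! ## §1. Boxes of sites and plaquettes on the torus `T^{(j)}` and their cardinalities -/

section Box

variable {P : Params} {j : ℕ}

/-- The box of lattice sites of `T^{(j)}` with corner `a` and `n` sites per direction: the translates `a + t`,
`t ∈ [0, n)^d` — the formal content of *"contained in a cube of the size …"* / *"rectangular parallelepipeds"* for the
regions `Λ ⊃ Z″_k ⊃ ⋯ ⊃ Z″_{h+1}` (only cardinality upper bounds are drawn from it, so a possible wrap-around on the torus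
is immaterial). [cite: Balaban1989LargeFieldI, condition (i) p.177] -/
def boxSites (a : Site P j) (n : ℕ) : Finset (Site P j) :=
  (Fintype.piFinset fun _ : Fin P.d => Finset.range n).image
    (fun t : Fin P.d → ℕ => fun c => a c + ((t c : ℕ) : ZMod (P.sitesPerDir j)))

/-- Membership in the box: `x = a + t` with `0 ≦ t_c < n`. [cite: Balaban1989LargeFieldI, condition (i) p.177] -/
theorem mem_boxSites {a : Site P j} {n : ℕ} {x : Site P j} :
    x ∈ boxSites a n ↔
      ∃ t : Fin P.d → ℕ, (∀ c, t c < n) ∧ x = fun c => a c + ((t c : ℕ) : ZMod (P.sitesPerDir j)) := by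
  unfold boxSites
  simp only [Finset.mem_image, Fintype.mem_piFinset, Finset.mem_range]
  constructor
  · rintro ⟨t, ht, rfl⟩
    exact ⟨t, ht, rfl⟩
  · rintro ⟨t, ht, rfl⟩
    exact ⟨t, ht, rfl⟩

/-- A box with `n` sites per direction has at most `n^d` sites (the volume count *"|Λ| ≦ (100M)⁴"* of B16 p. 357 and
the cube counts of [IV] condition (i) are instances). [cite: Balaban1989LargeFieldI, condition (i) p.177] -/
theorem card_boxSites_le (a : Site P j) (n : ℕ) : (boxSites a n).card ≤ n ^ P.d := by
  unfold boxSites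
  refine Finset.card_image_le.trans ?_
  rw [Fintype.card_piFinset, Finset.prod_const, Finset.card_range, Finset.card_univ, Fintype.card_fin]

/-- A set of sites inside a box has at most `n^d` elements. [cite: Balaban1989LargeFieldI, condition (i) p.177] -/
theorem card_le_of_subset_boxSites (Λ : Finset (Site P j)) (a : Site P j) (n : ℕ) (hΛ : Λ ⊆ boxSites a n) :
    Λ.card ≤ n ^ P.d :=
  (Finset.card_le_card hΛ).trans (card_boxSites_le a n)

/-- Real-threshold form: `Λ ⊆` a box of `n ≦ T` sites per direction gives `|Λ| ≦ T^d`. [cite: Balaban1989LargeFieldI, condition (i) p.177] -/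
theorem card_le_of_subset_boxSites_real (Λ : Finset (Site P j)) (a : Site P j) (n : ℕ) {T : ℝ}
    (hΛ : Λ ⊆ boxSites a n) (hn : (n : ℝ) ≤ T) : (Λ.card : ℝ) ≤ T ^ P.d := by
  have h1 : (Λ.card : ℝ) ≤ (n : ℝ) ^ P.d := by exact_mod_cast card_le_of_subset_boxSites Λ a n hΛ
  exact h1.trans (pow_le_pow_left₀ (Nat.cast_nonneg n) hn _)

/-- The plaquettes of `T^{(j)}` whose base point `x(p)` lies in the box — the support set of a cut-off `ζ₁(x(p))`
localized in a parallelepiped (B16 p. 360: `ζ₁ ∈ C₀^∞(Z″_{h+1})`). [cite: Balaban1989LargeFieldII, (1.18) p.360] -/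
def boxPlaqs (a : Site P j) (n : ℕ) : Finset (Plaq P j) :=
  Finset.univ.filter (fun p => p.src ∈ boxSites a n)

/-- Membership: the base point lies in the box. [cite: Balaban1989LargeFieldII, (1.18) p.360] -/
theorem mem_boxPlaqs {a : Site P j} {n : ℕ} {p : Plaq P j} : p ∈ boxPlaqs a n ↔ p.src ∈ boxSites a n := by
  simp [boxPlaqs]

/-- A plaquette is determined by its base point and its ordered pair of directions, so a box with `n` sites per
direction carries at most `d²·n^d` plaquettes (the exact factor is `d(d−1)/2`; only an upper bound is used).
[cite: Balaban1989LargeFieldII, (1.31) p.364] -/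
theorem card_boxPlaqs_le (a : Site P j) (n : ℕ) : (boxPlaqs a n).card ≤ P.d ^ 2 * n ^ P.d := by
  classical
  have hmaps : ∀ p ∈ boxPlaqs a n, (fun p : Plaq P j => (p.src, p.μ, p.ν)) p ∈
      boxSites a n ×ˢ ((Finset.univ : Finset (Fin P.d)) ×ˢ (Finset.univ : Finset (Fin P.d))) := by
    intro p hp
    have hp' : p.src ∈ boxSites a n := mem_boxPlaqs.mp hp
    simp [hp']
  have hinj : Set.InjOn (fun p : Plaq P j => (p.src, p.μ, p.ν)) (boxPlaqs a n : Set (Plaq P j)) := by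
    intro p _ q _ h
    obtain ⟨s, μ, ν, hμν⟩ := p
    obtain ⟨s', μ', ν', hμν'⟩ := q
    simp only [Prod.mk.injEq] at h
    obtain ⟨h1, h2, h3⟩ := h
    subst h1; subst h2; subst h3
    rfl
  calc (boxPlaqs a n).card
      ≤ (boxSites a n ×ˢ ((Finset.univ : Finset (Fin P.d)) ×ˢ (Finset.univ : Finset (Fin P.d)))).card :=
        Finset.card_le_card_of_injOn _ (fun p hp => Finset.mem_coe.mpr (hmaps p (Finset.mem_coe.mp hp))) hinj
    _ = (boxSites a n).card * (P.d * P.d) := by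
        rw [Finset.card_product, Finset.card_product, Finset.card_univ, Fintype.card_fin]
    _ ≤ n ^ P.d * (P.d * P.d) := Nat.mul_le_mul_right _ (card_boxSites_le a n)
    _ = P.d ^ 2 * n ^ P.d := by ring

/-- Real-threshold form of the plaquette count: `n ≦ T` sites per direction gives `#(boxPlaqs a n) ≦ d²·T^d`. [cite: Balaban1989LargeFieldII, (1.31) p.364] -/
theorem card_boxPlaqs_le_real (a : Site P j) (n : ℕ) {T : ℝ} (hn : (n : ℝ) ≤ T) :
    ((boxPlaqs a n).card : ℝ) ≤ (P.d : ℝ) ^ 2 * T ^ P.d := by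
  have h1 : ((boxPlaqs a n).card : ℝ) ≤ (P.d : ℝ) ^ 2 * (n : ℝ) ^ P.d := by
    exact_mod_cast card_boxPlaqs_le a n
  exact h1.trans (mul_le_mul_of_nonneg_left (pow_le_pow_left₀ (Nat.cast_nonneg n) hn _) (by positivity))

end Box

/-! ## §2. (1.31): the support count of `ζ₁` from the box of `Z″_{h+1}`, and the row AS TYPED -/

section Ineq131

variable {P : Params} {j : ℕ} {G : Type*} [GaugeGroup G]

/-- **The support count behind (1.31)** (p. 364 [PDF 10]; [IV] p. 177 (i)/(ii), (1.11) p. 179, p. 195): at `d = 4`, if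
`supp ζ₁ ⊂ Z″_{h+1}` lies in a box of `n` fine-lattice sites per direction with `n ≦ C₀·M·R_{h+1}·L·L^{−N}·η⁻¹` (a cube of
`C₀MR_{h+1}` scale-`(h+1)` units, scale-`(h+1)` spacing `L·L^{−N}`, fine spacing `η`; `Linv` = `L⁻¹`, `Rh` = `R_{h+1}`),
then the number of plaquettes in the box is at most `(16C₀⁴L⁴)·M⁴R_{h+1}⁴(L⁻¹)^{4N}(η⁴)⁻¹` — the hypothesis `hS` of
`B16Ineq131Assembly.ineq131_of_inputs` with `C₁ = 16C₀⁴L⁴`. PROVED. [cite: Balaban1989LargeFieldII, (1.31) p.364; Balaban1989LargeFieldI, condition (i)–(ii) p.177, (1.11) p.179] -/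
theorem suppCount131_of_box (hd : P.d = 4) (a : Site P j) (n : ℕ) {C₀ M Rh L Linv η : ℝ} {N : ℕ}
    (hn : (n : ℝ) ≤ C₀ * M * Rh * L * Linv ^ N * η⁻¹) :
    ((boxPlaqs a n).card : ℝ) ≤ (16 * C₀ ^ 4 * L ^ 4) * M ^ 4 * Rh ^ 4 * Linv ^ (4 * N) * (η ^ 4)⁻¹ := by
  have h := card_boxPlaqs_le_real a n hn
  rw [hd] at h
  have e : (C₀ * M * Rh * L * Linv ^ N * η⁻¹) ^ 4 = C₀ ^ 4 * L ^ 4 * M ^ 4 * Rh ^ 4 * Linv ^ (4 * N) * (η ^ 4)⁻¹ := by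
    have e1 : Linv ^ (4 * N) = (Linv ^ N) ^ 4 := by rw [mul_comm, pow_mul]
    rw [e1, ← inv_pow]; ring
  calc ((boxPlaqs a n).card : ℝ) ≤ ((4 : ℕ) : ℝ) ^ 2 * (C₀ * M * Rh * L * Linv ^ N * η⁻¹) ^ 4 := h
    _ = (16 * C₀ ^ 4 * L ^ 4) * M ^ 4 * Rh ^ 4 * Linv ^ (4 * N) * (η ^ 4)⁻¹ := by rw [e]; norm_num; ring

/-- **(1.31) AS TYPED, with the support count DERIVED from the box of `Z″_{h+1}`** (p. 364 [PDF 10], render p010):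
`B16Sect1Wilson.Ineq131 (A(ζ₁, U₀)) g_k L⁻¹ N β₀ (16C₀⁴L⁴C₂²C₃⁴ + 1) A₀ B₃ B₅ M R_k p₀(g_k)` — i.e. `0 ≦ A(ζ₁, U₀)` and
`A(ζ₁, U₀) < g_k²L^{−4N}N^{4β₀}·O(1)·A₀²B₃²B₅²M^{14}R_k⁴p₀²(g_k)` with the `O(1)` explicit — for a weight `0 ≦ ζ₁ ≦ 1`
supported in the plaquettes of a box of `n ≦ C₀MR_{h+1}·L·L^{−N}·η⁻¹` fine sites per direction (`d = 4`; [IV] (ii)+(i) on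
scale `h + 1`, `C₀ = 100` as printed, (1.11), p. 195), a configuration `U₀` obeying the (1.80) [IV]-shape deviation
`|U₀(∂p) − 1| ≦ C₂B₃B₅M⁵ε_kη²` on that box, the trace inequality `1 − Re tr g ≦ κ|g − 1|²` (`κ ≦ 1`), `ε_k = g_kA₀p₀(g_k)`
and `R_{h+1} ≦ C₃N^{β₀}R_k`: `B16Ineq131Assembly.ineq131_of_inputs` with its count hypothesis supplied by
`suppCount131_of_box`. PROVED. [cite: Balaban1989LargeFieldII, (1.31) p.364; Balaban1989LargeFieldI, condition (i)–(ii) p.177, (1.80) p.195] -/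
theorem ineq131_of_box (hd : P.d = 4) (ζ₁ : Plaq P j → ℝ) (U₀ : GaugeField P j G) (a : Site P j) (n : ℕ)
    {κ C₀ C₂ C₃ M Rh Rk Linv L B₃ B₅ εk η gk A₀ p₀ β₀ : ℝ} {N : ℕ}
    (hζ0 : ∀ p, 0 ≤ ζ₁ p) (hζ1 : ∀ p, ζ₁ p ≤ 1) (hsupp : ∀ p, p ∉ boxPlaqs a n → ζ₁ p = 0)
    (hquad : ∀ g : G, 1 - reTr g ≤ κ * dist1 g ^ 2) (hκ : κ ≤ 1)
    (hdev : ∀ p ∈ boxPlaqs a n, dist1 (plaqHol U₀ p) ≤ C₂ * B₃ * B₅ * M ^ 5 * εk * η ^ 2)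
    (hn : (n : ℝ) ≤ C₀ * M * Rh * L * Linv ^ N * η⁻¹)
    (hM : 0 ≤ M) (hRh : 0 ≤ Rh) (hL : 0 ≤ Linv) (hη : η ≠ 0)
    (hε : εk = gk * A₀ * p₀) (hR : Rh ≤ C₃ * (N : ℝ) ^ β₀ * Rk)
    (hpos : 0 < gk ^ 2 * Linv ^ (4 * N) * (N : ℝ) ^ (4 * β₀) * A₀ ^ 2 * B₃ ^ 2 * B₅ ^ 2 * M ^ 14 * Rk ^ 4 * p₀ ^ 2) :
    Ineq131 (wilsonLoc ζ₁ U₀) gk Linv N β₀ ((16 * C₀ ^ 4 * L ^ 4) * C₂ ^ 2 * C₃ ^ 4 + 1) A₀ B₃ B₅ M Rk p₀ :=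
  B16Ineq131Assembly.ineq131_of_inputs ζ₁ U₀ (boxPlaqs a n) hζ0 hζ1 hsupp hquad hκ hdev
    (by positivity) hM hRh hL hη (suppCount131_of_box hd a n hn) hε hR hpos

end Ineq131

/-! ## §3. (1.47): the count `|Γ″_h ∩ Ω″^{~2}_{h+1}| ≦ O(1)M⁴R_k⁵` from the box of `Z″_{h+1}` on scale `h` -/

section Ineq147

variable {P : Params} {j : ℕ}

/-- **The count behind the last step of (1.47)** (p. 368 [PDF 14]): a set `Γ` of scale-`h` lattice points (here: the
points of `Γ″_h ∩ Ω″^{~2}_{h+1}`, which lie in `Z″_{h+1}` by (1.12)–(1.13) [IV]) inside a box of `n ≦ C₀·L·M·R_{h+1}`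
scale-`h` sites per direction (the cube of `C₀MR_{h+1}` scale-`(h+1)` units of [IV] (ii)+(i), scale-`(h+1)` spacing = `L`
scale-`h` spacings), with `R_{h+1} ≦ C₃N^{β₀}R_k`, `4β₀ ≦ 1` and `1 ≦ N ≦ R_k` (*"N ≦ R_k"* p. 361,
`B16Sect1Kernels.NWindowUpper`), has `|Γ| ≦ (C₀LC₃)⁴M⁴R_k⁵` (`d = 4`; `N^{4β₀} ≦ N ≦ R_k` supplies the fifth power) — the
hypothesis `hΓ` of `B16Sect1Statements.ineq147_lastStep` with `C' = (C₀LC₃)⁴`. PROVED. [cite: Balaban1989LargeFieldII, (1.47) p.368; Balaban1989LargeFieldI, condition (i)–(ii) p.177, (1.12)–(1.13) p.179] -/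
theorem cardΓ147_of_box (hd : P.d = 4) (Γ : Finset (Site P j)) (a : Site P j) (n : ℕ)
    {C₀ L M Rh C₃ Rk β₀ : ℝ} {N : ℕ}
    (hΓ : Γ ⊆ boxSites a n) (hn : (n : ℝ) ≤ C₀ * L * M * Rh) (hRh : 0 ≤ Rh)
    (hR : Rh ≤ C₃ * (N : ℝ) ^ β₀ * Rk) (hβ : 4 * β₀ ≤ 1) (hN1 : 1 ≤ N)
    (hN : B16Sect1Kernels.NWindowUpper N Rk) :
    (Γ.card : ℝ) ≤ (C₀ * L * C₃) ^ 4 * M ^ 4 * Rk ^ 5 := by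
  have hN' : (N : ℝ) ≤ Rk := hN
  have hN1' : (1 : ℝ) ≤ N := by exact_mod_cast hN1
  have h1 : (Γ.card : ℝ) ≤ (C₀ * L * M * Rh) ^ 4 := by
    have := card_le_of_subset_boxSites_real Γ a n hΓ hn
    rwa [hd] at this
  -- R_{h+1}^4 ≤ (C₃ N^{β₀} R_k)^4
  have h2 : Rh ^ 4 ≤ (C₃ * (N : ℝ) ^ β₀ * Rk) ^ 4 := pow_le_pow_left₀ hRh hR 4
  -- N^{4β₀} ≤ N ≤ R_k
  have h3 : ((N : ℝ) ^ β₀) ^ 4 ≤ Rk := by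
    have e : ((N : ℝ) ^ β₀) ^ 4 = (N : ℝ) ^ (4 * β₀) := by
      rw [← Real.rpow_natCast ((N : ℝ) ^ β₀) 4, ← Real.rpow_mul (Nat.cast_nonneg N)]
      norm_num [mul_comm]
    rw [e]
    calc (N : ℝ) ^ (4 * β₀) ≤ (N : ℝ) ^ (1 : ℝ) := Real.rpow_le_rpow_of_exponent_le hN1' hβ
      _ = N := Real.rpow_one _
      _ ≤ Rk := hN'
  have hRk : 0 ≤ Rk := le_trans (by positivity) hN'
  have hNβ : 0 ≤ ((N : ℝ) ^ β₀) ^ 4 := by positivity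
  calc (Γ.card : ℝ) ≤ (C₀ * L * M * Rh) ^ 4 := h1
    _ = (C₀ * L) ^ 4 * M ^ 4 * Rh ^ 4 := by ring
    _ ≤ (C₀ * L) ^ 4 * M ^ 4 * (C₃ * (N : ℝ) ^ β₀ * Rk) ^ 4 := mul_le_mul_of_nonneg_left h2 (by positivity)
    _ = (C₀ * L * C₃) ^ 4 * M ^ 4 * Rk ^ 4 * ((N : ℝ) ^ β₀) ^ 4 := by ring
    _ ≤ (C₀ * L * C₃) ^ 4 * M ^ 4 * Rk ^ 4 * Rk := mul_le_mul_of_nonneg_left h3 (by positivity)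
    _ = (C₀ * L * C₃) ^ 4 * M ^ 4 * Rk ^ 5 := by ring

/-- **The last step of (1.47) with its count input DISCHARGED** (p. 368 [PDF 14], render p014): the penultimate
expression `O(1)A₀C₁B₃³B₅M⁶p₀(g_k)q₁(g_k)R_k²L^{−N}|Γ″_h ∩ Ω″^{~2}_{h+1}|` is at most the final
`O(1)A₀C₁B₃³B₅M^{10}p₀(g_k)q₁(g_k)R_k⁷L^{−N}` with `O(1) = C·(C₀LC₃)⁴`, the count being `cardΓ147_of_box`
(`B16Sect1Statements.ineq147_lastStep` BY NAME). PROVED. [cite: Balaban1989LargeFieldII, (1.47) p.368; Balaban1989LargeFieldI, condition (i)–(ii) p.177] -/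
theorem ineq147_lastStep_of_box (hd : P.d = 4) (Γ : Finset (Site P j)) (a : Site P j) (n : ℕ)
    {C A₀ C₁ B₃ B₅ M p₀g q₁g Rk Linv C₀ L Rh C₃ β₀ : ℝ} {N : ℕ}
    (hpre : 0 ≤ C * A₀ * C₁ * B₃ ^ 3 * B₅ * M ^ 6 * p₀g * q₁g * Rk ^ 2 * Linv ^ N)
    (hΓ : Γ ⊆ boxSites a n) (hn : (n : ℝ) ≤ C₀ * L * M * Rh) (hRh : 0 ≤ Rh)
    (hR : Rh ≤ C₃ * (N : ℝ) ^ β₀ * Rk) (hβ : 4 * β₀ ≤ 1) (hN1 : 1 ≤ N)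
    (hN : B16Sect1Kernels.NWindowUpper N Rk) :
    C * A₀ * C₁ * B₃ ^ 3 * B₅ * M ^ 6 * p₀g * q₁g * Rk ^ 2 * Linv ^ N * (Γ.card : ℝ) ≤
      (C * (C₀ * L * C₃) ^ 4) * A₀ * C₁ * B₃ ^ 3 * B₅ * M ^ 10 * p₀g * q₁g * Rk ^ 7 * Linv ^ N :=
  B16Sect1Statements.ineq147_lastStep hpre (cardΓ147_of_box hd Γ a n hΓ hn hRh hR hβ hN1 hN)

end Ineq147

/-! ## §4. p. 357/358: `|Λ| ≦ (100M)⁴` from *"Λ is contained in a cube of the size 100M"* -/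

section VolLambda

variable {P : Params} {j : ℕ}

/-- **p. 357 [PDF 3]** *"where we have used the fact that Λ is contained in a cube of the size 100M"* ([IV] p. 192: *"by
the condition (i) it is a rectangular parallelepiped contained in a cube of the size 100M"*): a set `Λ` of unit-lattice
sites inside a box of `n ≦ 100M` sites per direction has `|Λ| ≦ (100M)⁴` (`d = 4`) — the hypothesis `volΛ ≦ (100M)⁴` of
`B16Sect1Wilson.ineq16_arith`, `B16Sect1Wilson.ineq111_arith`, `B16Sect1Statements.denomLower358_M4`. PROVED.
[cite: Balaban1989LargeFieldII, (1.6) p.357; Balaban1989LargeFieldI, (1.73) p.192] -/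
theorem volΛ_le_of_box (hd : P.d = 4) (Λ : Finset (Site P j)) (a : Site P j) (n : ℕ) {M : ℝ}
    (hΛ : Λ ⊆ boxSites a n) (hn : (n : ℝ) ≤ 100 * M) : (Λ.card : ℝ) ≤ (100 * M) ^ 4 := by
  have := card_le_of_subset_boxSites_real Λ a n hΛ hn
  rwa [hd] at this

/-- **(1.6) p. 357 [PDF 3], middle expression ≦ final, with `|Λ|` the site count of a boxed `Λ`**: with `ε_k = g_kA₀p₀(g_k)`,
`δ·dist(Ω_k, Λ) ≧ R_k` and `Λ` inside a box of `n ≦ 100M` unit-lattice sites per direction,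
`(1/g_k)B₃M₀A₀p₀(g_k)exp(−δ dist(Ω_k, Λ))3ε_k|Λ| ≦ 3B₃M₀A₀²p₀²(g_k)exp(−R_k)(100M)⁴` (`B16Sect1Wilson.ineq16_arith` with
`hvol` supplied by `volΛ_le_of_box`). PROVED. [cite: Balaban1989LargeFieldII, (1.6) p.357] -/
theorem ineq16_mid_le_of_box (hd : P.d = 4) (Λ : Finset (Site P j)) (a : Site P j) (n : ℕ)
    (gk B₃ M₀ A₀ p₀g δ dist εk Rk M : ℝ) (hgk : 0 < gk) (hB : 0 ≤ B₃) (hM₀ : 0 ≤ M₀)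
    (hε : εk = gk * A₀ * p₀g) (hdist : Rk ≤ δ * dist) (hΛ : Λ ⊆ boxSites a n) (hn : (n : ℝ) ≤ 100 * M) :
    1 / gk * B₃ * M₀ * A₀ * p₀g * Real.exp (-(δ * dist)) * (3 * εk) * (Λ.card : ℝ) ≤
      3 * B₃ * M₀ * A₀ ^ 2 * p₀g ^ 2 * Real.exp (-Rk) * (100 * M) ^ 4 :=
  ineq16_arith gk B₃ M₀ A₀ p₀g δ dist εk (Λ.card : ℝ) Rk M hgk hB hM₀ hε hdist (Nat.cast_nonneg _)
    (volΛ_le_of_box hd Λ a n hΛ hn)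

/-- **(1.11) p. 358 [PDF 4], second inequality `O(1) log M|Λ| < O(1)M⁵` with `|Λ|` the site count of a boxed `Λ`**:
`C log M |Λ| ≦ (C·100⁴)M⁵` for `C ≧ 0`, `M ≧ 1` and `Λ` inside a box of `n ≦ 100M` unit-lattice sites per direction
(`B16Sect1Wilson.ineq111_arith` with `hvol` supplied by `volΛ_le_of_box`). PROVED. [cite: Balaban1989LargeFieldII, (1.11) p.358] -/
theorem ineq111_arith_of_box (hd : P.d = 4) (Λ : Finset (Site P j)) (a : Site P j) (n : ℕ) (C M : ℝ)
    (hC : 0 ≤ C) (hM : 1 ≤ M) (hΛ : Λ ⊆ boxSites a n) (hn : (n : ℝ) ≤ 100 * M) :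
    C * Real.log M * (Λ.card : ℝ) ≤ C * 100 ^ 4 * M ^ 5 :=
  ineq111_arith C M (Λ.card : ℝ) hC hM (Nat.cast_nonneg _) (volΛ_le_of_box hd Λ a n hΛ hn)

/-- **p. 358 [PDF 4], `exp(−O(1)|Λ|) = exp(−O(M⁴))` with `|Λ|` the site count of a boxed `Λ`**: if the `B′`-integral `I`
of (1.2) satisfies `exp(−C|Λ|) ≦ I` (`B16Sect1Statements.DenomLower358`, `C ≧ 0`) and `Λ` lies inside a box of `n ≦ 100M`
unit-lattice sites per direction, then `exp(−(C·100⁴)M⁴) ≦ I` (`B16Sect1Statements.denomLower358_M4` with `hvol` supplied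
by `volΛ_le_of_box`). PROVED. [cite: Balaban1989LargeFieldII, p.358 (before (1.10))] -/
theorem denomLower358_of_box (hd : P.d = 4) (Λ : Finset (Site P j)) (a : Site P j) (n : ℕ) {I C M : ℝ}
    (hC : 0 ≤ C) (hΛ : Λ ⊆ boxSites a n) (hn : (n : ℝ) ≤ 100 * M)
    (h : B16Sect1Statements.DenomLower358 I C (Λ.card : ℝ)) : Real.exp (-(C * 100 ^ 4 * M ^ 4)) ≤ I :=
  B16Sect1Statements.denomLower358_M4 hC (volΛ_le_of_box hd Λ a n hΛ hn) h

end VolLambda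

end Literature.MathematicalPhysics.QuantumFieldTheory.Balaban1983to89.B16Sect1BoxCounts
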